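import Summits.HubbardSuperconductivity.HubbardSuperconductivity.Theorems.LiebTwinDWavePolarisedDiscordanceTotalPairWeight
import Summits.HubbardSuperconductivity.HubbardSuperconductivity.Theorems.LiebTwinDWavePolarisedDiscordanceCooperPairWeight
import HarnessLib

/-!
# Route `LiebTwin`, crux `DWavePolarisedDiscordance` (stmt-HubbardSuperconductivity-15314), line `Sketch`:
# the leak is `L²/4` times the Cooper-pair occupancy transfer (helper, `--supports`, stub `stub_leakCooperReading`)

Combining the landed `sum_expect_channelField_twin_sub` (`Σ_r‖Δ_rφ̃‖² − Σ_r‖Δ_rφ‖² = 4·Leak(φ)`, p165212) with the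
operator identity `Σ_r Δ_rᴴΔ_r = L²·Σ_k b_kᴴ b_k` (`stub_cooperPairWeight`, p165453): for EVERY `(n,n)`-sector vector
`φ` of the torus,

  `4·Leak(φ) = L² · Σ_k ( ⟨φ̃, b_kᴴ b_k φ̃⟩ − ⟨φ, b_kᴴ b_k φ⟩ )`,  `b_k = c_{−k↓} c_{k↑}`, `φ̃ = liebVec n |liebW n φ|`,

so the registered physics stub `stub_leakBound` (`32·Leak ≤ η·m + εL⁴` along ground states) says EXACTLY: the twin of a
ground state occupies at most `η·m/(8L²) + εL²/8` more Cooper pairs `(k↑, −k↓)` than the ground state itself. (BCS-type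
states: `⟨b_kᴴb_k⟩ = ⟨n_k⟩` is already maximal, so the transfer is `≤ 0`; η_π-tower: the transfer is the whole mass,
`32·Leak = 4m`.) Finite bookkeeping; no definition, no named fact. [folklore]
-/

-- the mandated namespace `Summit.<Summit>.<Problem>.Theorems` repeats `HubbardSuperconductivity` (D-0017)
set_option linter.dupNamespace false

noncomputable section

namespace Summit.HubbardSuperconductivity.HubbardSuperconductivity.Theorems.LiebTwinChannelExhaustion

open Matrix Finset Literature.MathematicalPhysics.QuantumLattice Literature.Probability.LatticeModels
open scoped ComplexOrder MatrixOrder Matrix.Norms.L2Operator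

variable {L : ℕ} [NeZero L]

/-- The total relative-channel pair weight of any Fock vector is `L²` times its Cooper-pair occupancy:
`Σ_r ⟨ψ, Δ_rᴴ Δ_r ψ⟩ = L² Σ_k ⟨ψ, b_kᴴ b_k ψ⟩`. [folklore] -/
theorem sum_expect_channelField_eq_cooper (ψ : Fock (Orb (FermionTorus 2 L))) :
    ∑ r : TorusSite 2 L, expect ((∑ x : TorusSite 2 L, annihilation (orb (FermionTorus.ofTorusSite x) 0) *
          annihilation (orb (FermionTorus.ofTorusSite (x + r)) 1))ᴴ *
        (∑ x' : TorusSite 2 L, annihilation (orb (FermionTorus.ofTorusSite x') 0) *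
          annihilation (orb (FermionTorus.ofTorusSite (x' + r)) 1))) ψ =
      (L : ℂ) ^ 2 * ∑ k : TorusSite 2 L, expect ((pairMode k)ᴴ * pairMode k) ψ := by
  have h := congrArg (fun M => Literature.MathematicalPhysics.QuantumLattice.expect M ψ)
    (sum_channelField_conjTranspose_mul_self (L := L))
  simp only [Literature.MathematicalPhysics.QuantumLattice.expect, Matrix.sum_mulVec, dotProduct_sum,
    Matrix.smul_mulVec, dotProduct_smul, smul_eq_mul] at h ⊢
  rw [h, Finset.mul_sum]

/-- **STUB `stub_leakCooperReading`** of crux `DWavePolarisedDiscordance` (stmt-HubbardSuperconductivity-15314), line `Sketch`: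
for every `(n,n)`-sector vector `φ` of the torus, `4·Leak(φ) = L²·Σ_k (⟨φ̃, b_kᴴb_kφ̃⟩ − ⟨φ, b_kᴴb_kφ⟩).re` — the leak is the
Cooper-pair occupancy transfer from the state to its twin. [folklore] -/
theorem stub_leakCooperReading :
    open Literature.MathematicalPhysics.QuantumLattice Literature.Probability.LatticeModels in
    open scoped MatrixOrder Matrix.Norms.L2Operator in
    ∀ (L : ℕ) [NeZero L] (n : ℕ) (φ : Fock (Orb (FermionTorus 2 L))), IsInSector n n φ →
      (∑ a : TorusSite 2 L,
        (((CFC.abs (liebW n φ))ᴴ *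
              (∑ x : TorusSite 2 L, configHop n (FermionTorus.ofTorusSite x) (FermionTorus.ofTorusSite (x + a))) *
              CFC.abs (liebW n φ) *
              (∑ x : TorusSite 2 L,
                configHop n (FermionTorus.ofTorusSite x) (FermionTorus.ofTorusSite (x + a)))ᵀ).trace -
          ((liebW n φ)ᴴ *
              (∑ x : TorusSite 2 L, configHop n (FermionTorus.ofTorusSite x) (FermionTorus.ofTorusSite (x + a))) *
              liebW n φ *
              (∑ x : TorusSite 2 L,
                configHop n (FermionTorus.ofTorusSite x) (FermionTorus.ofTorusSite (x + a)))ᵀ).trace)).re =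
        (L : ℝ) ^ 2 * ((∑ k : TorusSite 2 L, expect ((pairMode k)ᴴ * pairMode k) (liebVec n (CFC.abs (liebW n φ)))).re -
          (∑ k : TorusSite 2 L, expect ((pairMode k)ᴴ * pairMode k) φ).re) := by
  intro L _ n φ hφ
  rw [← sum_expect_channelField_twin_sub hφ, sum_expect_channelField_eq_cooper, sum_expect_channelField_eq_cooper]
  have hre : ∀ z : ℂ, ((L : ℂ) ^ 2 * z).re = (L : ℝ) ^ 2 * z.re := by
    intro z
    rw [show ((L : ℂ) ^ 2) = (((L : ℝ) ^ 2 : ℝ) : ℂ) by push_cast; ring, Complex.re_ofReal_mul]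
  rw [hre, hre]
  ring

end Summit.HubbardSuperconductivity.HubbardSuperconductivity.Theorems.LiebTwinChannelExhaustion

end
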